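import Mathlib
import HarnessLib
import Literature.Computability.MetaComplexity.TruthTables
import Literature.Computability.MetaComplexity.MCSPTreeWalk

/-!
# Truth tables split into blocks along the top variables (`stub_truthTable_blocks`)

Route `UniformStream`, crux `UniformStreamLB` (stmt-PneNP-16045), line `birth`: the registered stub
`stub_truthTable_blocks` (`--supports stmt-PneNP-16045`), the pure index bookkeeping behind the
block / fooling argument on truth tables of the low levels of the crux matrix.

**Theorem (`stub_truthTable_blocks`).** In the tree's LSB-first enumeration `boolFunEquivFin`
(`v ↦ ∑ i, [v i]·2^i`) of the Boolean cube, the truth table of the `(m+j)`-variable function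
`x ↦ G (top j coordinates of x) (low m coordinates of x)` is the concatenation, over
`t = 0, 1, …, 2^j - 1` (in the order `boolFunEquivFin j`), of the truth tables of the `G t`.

*Proof.* `2^(m+j) = 2^m · 2^j`, so `List.ofFn_mul'` writes the left table as the concatenation over
`t < 2^j` of the lists `r ↦ F(point number 2^m·t + r)`, `r < 2^m`. Coordinate `c` of point number
`v` is the binary digit `v.testBit c` (the tree's `boolFunEquivFin_symm_apply_eq_testBit`,
`MCSPTreeWalk.lean`), and `(2^m·t + r).testBit c` is `r.testBit c` for `c < m` and `t.testBit (c - m)`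
for `c ≥ m` (`Nat.testBit_two_pow_mul_add`); hence the low `m` coordinates of point `2^m·t + r` form
point number `r` of `{0,1}^m` and its top `j` coordinates form point number `t` of `{0,1}^j`
(`boolFunEquivFin_apply_eq_of_testBit`), so the `r`-th entry of block `t` is `G t (point r)`, the
`r`-th bit of `truthTable (G t)`. [folklore]
-/

namespace Summit.PneNP.PneNP.Theorems.UniformStreamLB.Birth

open Literature.Computability.Complexity Literature.Computability.MetaComplexity

namespace TruthTableBlocks

/-- **Splitting an enumeration of `Fin (2^(m+j))` into `2^j` blocks of length `2^m`**: the list of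
values of `f` on `0, 1, …, 2^(m+j) - 1` is the concatenation over `t < 2^j` of the lists of values on
`2^m·t + r`, `r < 2^m` (Mathlib's `List.ofFn_mul'` transported along `2^(m+j) = 2^m · 2^j`).
[folklore] -/
theorem ofFn_two_pow_add (α : Type*) (m j : ℕ) (f : Fin (2 ^ (m + j)) → α) :
    List.ofFn f =
      (List.ofFn fun t : Fin (2 ^ j) => List.ofFn fun r : Fin (2 ^ m) =>
        f ⟨2 ^ m * (t : ℕ) + r, by
          calc 2 ^ m * (t : ℕ) + r < 2 ^ m * (t + 1) := by rw [Nat.mul_add, Nat.mul_one]; omega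
            _ ≤ 2 ^ m * 2 ^ j := Nat.mul_le_mul_left _ t.isLt
            _ = 2 ^ (m + j) := (pow_add 2 m j).symm⟩).flatten := by
  rw [List.ofFn_congr (pow_add 2 m j) f, List.ofFn_mul']
  rfl

end TruthTableBlocks

open TruthTableBlocks in
/-- **Stub LOW-T (truth tables split into blocks along the top variables).** In the tree's LSB-first
enumeration `boolFunEquivFin`, the truth table of an `(m+j)`-variable function is the concatenation, over
the `2^j` values `t` of the top `j` variables (in the order `boolFunEquivFin j`), of the truth tables of its
restrictions to the low `m` variables. [folklore] -/
theorem stub_truthTable_blocks (m j : ℕ) (G : Fin (2 ^ j) → (Fin m → Bool) → Bool) :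
    truthTable (fun x : Fin (m + j) → Bool =>
        G (boolFunEquivFin j fun i => x (Fin.natAdd m i)) fun i => x (Fin.castAdd j i)) =
      (List.ofFn fun t : Fin (2 ^ j) => truthTable (G t)).flatten := by
  simp only [truthTable]
  rw [ofFn_two_pow_add]
  refine congrArg List.flatten (List.ofFn_inj.2 (funext fun t => List.ofFn_inj.2 (funext fun r => ?_)))
  have hbit : ∀ c : ℕ, (2 ^ m * (t : ℕ) + r).testBit c =
      if c < m then (r : ℕ).testBit c else (t : ℕ).testBit (c - m) := fun c =>
    Nat.testBit_two_pow_mul_add (t : ℕ) r.isLt c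
  simp only [boolFunEquivFin_symm_apply_eq_testBit, Fin.val_natAdd, Fin.val_castAdd, hbit]
  congr 1
  · refine Fin.ext (boolFunEquivFin_apply_eq_of_testBit _ t.isLt fun i => ?_)
    simp
  · funext i
    rw [boolFunEquivFin_symm_apply_eq_testBit, if_pos i.isLt]

end Summit.PneNP.PneNP.Theorems.UniformStreamLB.Birth
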